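import Literature.NumberTheory.Automorphic.UnitaryGroupBorelPair     -- ★ `mem_unitaryGroupOfForm_antidiagonal_iff_sum'`
import HarnessLib

/-!
# The `U(1,1) ↔ GL₂(F)` dictionary: `U(σ, antidiag(1,1))(E) = E^× · D₁⁻¹ GL₂(F) D₁`
(Flicker (1998), *Elementary proof of the fundamental lemma for a unitary group*, proof of Prop. 6 p. 83:
«`U(0 1;1 0) = D₁⁻¹ U₂ D₁`, `D₁ = diag(√D, 1)`, and `E·U₂ = E·GL(2, E∕F)`, `GL(2, E∕F) = {g ∈ GL(2,F) : det g ∈ N E^×}`»)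

Topic `NumberTheory/Automorphic`; namespace `Literature.NumberTheory.Automorphic.UnitaryGroup.SplitDictionary`.  KERNEL mathematics only: theorems, no
definition, no named fact, no instance, no notation, no `sorry`.  Cell `pub/hodgecm-mathlib`, programme P3a, road «D-N7-inert», MAP v3 «N7-ns COUNT FROM
FLICKER», brick (F3c-γ) «LATTICE ↔ COSET TRANSPORT» FILE γ0 (LEAD F0P3a-plan (g9) T8-60 (C); architect A-p06 (g26); B-p04 (g33)'s census: «the tree has no
`U(1,1) ↔ GL₂` bridge»).  HC_CM is proved only modulo the printed citations (2 remaining named inputs hLiu418, h413) until rung 0 closes; this file discharges no named fact.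

MATHEMATICS (a field `K` = Flicker's `E` with an involution `σ`, `F = K^σ`, `2 ≠ 0`, `d ∈ K` with `σd = −d ≠ 0` = his `√D`).  For `u = (α β; γ δ)` with
`ᵗ(σu)·antidiag(1,1)·u = antidiag(1,1)`, i.e. the four relations (R1) `σα·γ + σγ·α = 0`, (R2) `σα·δ + σγ·β = 1`, (R3) `σβ·γ + σδ·α = 1`, (R4) `σβ·δ + σδ·β = 0`:
§1 `Δ := αδ − βγ ≠ 0`, **`σα = α∕Δ`, `σδ = δ∕Δ`, `σβ = −β∕Δ`, `σγ = −γ∕Δ`** (`σ(u) = S u S ∕ det u`, `S = diag(1,−1)`) and `Δ·σΔ = 1`; §2 HILBERT 90 in `σ`-form: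
**`Δ σΔ = 1 ⇒ Δ = λ ∕ σλ`** with `λ = 1 + Δ` or, if `Δ = −1`, `λ = 2d`; §3 **THE DICTIONARY**: `∃ λ ≠ 0` with `Δ = λ∕σλ` and
**`α∕λ, dβ∕λ, γ∕(dλ), δ∕λ ∈ F`** — i.e. `u = λ · D₁⁻¹ g D₁` with `g = (α∕λ, dβ∕λ; γ∕(dλ), δ∕λ) ∈ GL₂(F)`, `λσλ·det g = 1`, `D₁ = diag(d,1)` — and the converse (§4);
§5 the dress for `u ∈ U(σ, Φ₂)` (★ `unitaryGroupOfForm σ ((StdForm.antidiagonal 2).over K)`) and for the `U(1,1)`-block `!![α,0,β;0,e,0;γ,0,δ]` of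
`H = Z_{U(Φ₃)}(diag(1,−1,1))` (★ B-p17 `exists_coe_eq_block_of_mem_centralizer`).

References: [Flicker1998UnitaryFL] Y. Z. Flicker, Canad. J. Math. 50 (1998), proof of Prop. 6 p. 83 · [Rogawski1990] J. D. Rogawski, Ann. of Math. Stud. 123, §1.9 p. 8
(quasi-split unitary groups in two variables), §4.9 p. 55 (`H = U(2) × U(1)`). -/

set_option autoImplicit false

open Matrix
open scoped MatrixGroups

namespace Literature.NumberTheory.Automorphic.UnitaryGroup

namespace SplitDictionary

variable {K : Type*} [Field K] (σ : K →+* K)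

/-! ## §1 `σ(u) = S u S ∕ det u` from the four unitarity relations -/

section Relations

variable {α β γ δ : K}

/-- `σα · (αδ − βγ) = α`. [cite: Flicker1998UnitaryFL, Prop. 6 p. 83] -/
theorem map_a_mul_det (R1 : σ α * γ + σ γ * α = 0) (R2 : σ α * δ + σ γ * β = 1) : σ α * (α * δ - β * γ) = α := by
  linear_combination α * R2 - β * R1

/-- `σγ · (αδ − βγ) = −γ`. [cite: Flicker1998UnitaryFL, Prop. 6 p. 83] -/
theorem map_c_mul_det (R1 : σ α * γ + σ γ * α = 0) (R2 : σ α * δ + σ γ * β = 1) : σ γ * (α * δ - β * γ) = -γ := by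
  linear_combination δ * R1 - γ * R2

/-- `σδ · (αδ − βγ) = δ`. [cite: Flicker1998UnitaryFL, Prop. 6 p. 83] -/
theorem map_d_mul_det (R3 : σ β * γ + σ δ * α = 1) (R4 : σ β * δ + σ δ * β = 0) : σ δ * (α * δ - β * γ) = δ := by
  linear_combination δ * R3 - γ * R4

/-- `σβ · (αδ − βγ) = −β`. [cite: Flicker1998UnitaryFL, Prop. 6 p. 83] -/
theorem map_b_mul_det (R3 : σ β * γ + σ δ * α = 1) (R4 : σ β * δ + σ δ * β = 0) : σ β * (α * δ - β * γ) = -β := by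
  linear_combination α * R4 - β * R3

/-- `det u ≠ 0`. [cite: Flicker1998UnitaryFL, Prop. 6 p. 83] -/
theorem det_ne_zero (R1 : σ α * γ + σ γ * α = 0) (R2 : σ α * δ + σ γ * β = 1) : α * δ - β * γ ≠ 0 := by
  intro h
  have ha : α = 0 := by rw [← map_a_mul_det σ R1 R2, h, mul_zero]
  have hc : γ = 0 := by have := map_c_mul_det σ R1 R2; rw [h, mul_zero] at this; exact (neg_eq_zero.1 this.symm)
  have := R2
  rw [ha, hc, map_zero, zero_mul, zero_mul, add_zero] at this
  exact zero_ne_one this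

/-- `det u · σ(det u) = 1` (`det u ∈ E¹`). [cite: Flicker1998UnitaryFL, Prop. 6 p. 83] -/
theorem det_mul_map_det (R1 : σ α * γ + σ γ * α = 0) (R2 : σ α * δ + σ γ * β = 1) (R3 : σ β * γ + σ δ * α = 1)
    (R4 : σ β * δ + σ δ * β = 0) : (α * δ - β * γ) * σ (α * δ - β * γ) = 1 := by
  have hΔ := det_ne_zero σ R1 R2
  have ha := map_a_mul_det σ R1 R2
  have hb := map_b_mul_det σ R3 R4
  have hc := map_c_mul_det σ R1 R2
  have hd := map_d_mul_det σ R3 R4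
  -- multiply `σΔ = σα σδ − σβ σγ` by `Δ²`
  have key : (α * δ - β * γ) * (α * δ - β * γ) * σ (α * δ - β * γ) = (α * δ - β * γ) := by
    rw [map_sub, map_mul, map_mul]
    linear_combination (σ δ * (α * δ - β * γ)) * ha + α * hd - (σ γ * (α * δ - β * γ)) * hb + β * hc
  exact mul_left_cancel₀ hΔ (by rw [← mul_assoc, key, mul_one])

end Relations

/-! ## §2 Hilbert 90 in `σ`-form -/

/-- **Hilbert's Theorem 90 for a quadratic involution, explicit**: if `2 ≠ 0`, `σd = −d ≠ 0`, and `Δ σΔ = 1`, then `Δ = λ ∕ σλ` for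
`λ = 1 + Δ` (or `λ = d − Δd = 2d` when `Δ = −1`); in particular `λ ≠ 0` and `Δ · σλ = λ`. [cite: Flicker1998UnitaryFL, Prop. 6 p. 83] -/
theorem exists_mul_map_eq_of_mul_map_eq_one (h2 : (2 : K) ≠ 0) {d : K} (hd : σ d = -d) (hd0 : d ≠ 0)
    {Δ : K} (hΔ : Δ * σ Δ = 1) : ∃ l : K, l ≠ 0 ∧ Δ * σ l = l := by
  by_cases h1 : 1 + Δ = 0
  · have hΔ1 : Δ = -1 := by linear_combination h1
    refine ⟨2 * d, mul_ne_zero h2 hd0, ?_⟩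
    rw [map_mul, map_ofNat, hd, hΔ1]; ring
  · refine ⟨1 + Δ, h1, ?_⟩
    rw [map_add, map_one, mul_add, mul_one, hΔ, add_comm]

/-! ## §3 The dictionary `u = λ · D₁⁻¹ g D₁`, `g ∈ GL₂(F)` -/

/-- **THE `U(1,1) ↔ GL₂(F)` DICTIONARY** (Flicker p. 83 «`E·U₂ = E·GL(2, E∕F)`», conjugated by `D₁ = diag(d, 1)` to the form `antidiag(1,1)`):
for `u = (α β; γ δ)` satisfying the four `antidiag(1,1)`-unitarity relations there is `λ ≠ 0` with `det u = αδ − βγ = λ∕σλ` (`det u · σλ = λ`) such that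
**`α∕λ`, `d·β∕λ`, `γ∕(d·λ)`, `δ∕λ` are `σ`-FIXED** — i.e. `u = λ · D₁⁻¹ g D₁` with `g := (α∕λ, dβ∕λ; γ∕(dλ), δ∕λ) ∈ GL₂(F)`, `F = K^σ`, and
`λ σλ · det g = 1` (`det g ∈ N(E^×)`). [cite: Flicker1998UnitaryFL, Prop. 6 p. 83] -/
theorem exists_fixed_coords (h2 : (2 : K) ≠ 0) {d : K} (hd : σ d = -d) (hd0 : d ≠ 0) {α β γ δ : K}
    (R1 : σ α * γ + σ γ * α = 0) (R2 : σ α * δ + σ γ * β = 1) (R3 : σ β * γ + σ δ * α = 1) (R4 : σ β * δ + σ δ * β = 0) :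
    ∃ l : K, l ≠ 0 ∧ (α * δ - β * γ) * σ l = l ∧
      σ (α / l) = α / l ∧ σ (d * β / l) = d * β / l ∧ σ (γ / (d * l)) = γ / (d * l) ∧ σ (δ / l) = δ / l ∧
        l * σ l * (α / l * (δ / l) - d * β / l * (γ / (d * l))) = 1 := by
  have hΔ0 := det_ne_zero σ R1 R2
  have hΔ0' : α * δ - γ * β ≠ 0 := by rw [mul_comm γ β]; exact hΔ0
  have hΔ0'' : δ * α - β * γ ≠ 0 := by rw [mul_comm δ α]; exact hΔ0
  obtain ⟨l, hl0, hl⟩ := exists_mul_map_eq_of_mul_map_eq_one σ h2 hd hd0 (det_mul_map_det σ R1 R2 R3 R4)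
  have hσl0 : σ l ≠ 0 := fun h => hl0 (by rw [← hl, h, mul_zero])
  have ha := map_a_mul_det σ R1 R2
  have hb := map_b_mul_det σ R3 R4
  have hc := map_c_mul_det σ R1 R2
  have hdd := map_d_mul_det σ R3 R4
  -- `σx = ±x∕Δ` and `Δ σl = l` give `σ(x∕l) = ±x∕(Δ σl) = ±x∕l`
  have eα : σ α = α / (α * δ - β * γ) := by rw [eq_div_iff hΔ0]; exact ha
  have eδ : σ δ = δ / (α * δ - β * γ) := by rw [eq_div_iff hΔ0]; exact hdd
  have eβ : σ β = -β / (α * δ - β * γ) := by rw [eq_div_iff hΔ0]; exact hb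
  have eγ : σ γ = -γ / (α * δ - β * γ) := by rw [eq_div_iff hΔ0]; exact hc
  have el : σ l = l / (α * δ - β * γ) := by rw [eq_div_iff hΔ0, mul_comm]; exact hl
  refine ⟨l, hl0, hl, ?_, ?_, ?_, ?_, ?_⟩
  · rw [map_div₀, eα, el]; field_simp
  · rw [map_div₀, map_mul, hd, eβ, el]; field_simp
  · rw [map_div₀, map_mul, hd, eγ, el]; field_simp
  · rw [map_div₀, eδ, el]; field_simp
  · have : l * σ l * (α / l * (δ / l) - d * β / l * (γ / (d * l))) = (α * δ - β * γ) * σ l / l := by field_simp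
    rw [this, hl, div_self hl0]

/-! ## §4 The converse: `λ · D₁⁻¹ GL₂(F)^{N} D₁ ⊆ U(1,1)` -/

/-- Conversely, for `σ`-fixed `a b c e` (`g = (a b; c e) ∈ GL₂(F)`) and `λ` with `λ σλ · det g = 1`, the matrix `u = λ · D₁⁻¹ g D₁ = (λa, λb∕d; λcd, λe)` satisfies
the four `antidiag(1,1)`-unitarity relations. [cite: Flicker1998UnitaryFL, Prop. 6 p. 83] -/
theorem rel_of_fixed_coords {d : K} (hd : σ d = -d) (hd0 : d ≠ 0) {a b c e l : K}
    (ha : σ a = a) (hb : σ b = b) (hc : σ c = c) (he : σ e = e) (hN : l * σ l * (a * e - b * c) = 1) :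
    σ (l * a) * (l * c * d) + σ (l * c * d) * (l * a) = 0 ∧ σ (l * a) * (l * e) + σ (l * c * d) * (l * b / d) = 1 ∧
      σ (l * b / d) * (l * c * d) + σ (l * e) * (l * a) = 1 ∧ σ (l * b / d) * (l * e) + σ (l * e) * (l * b / d) = 0 := by
  have hσd0 : σ d ≠ 0 := by rw [hd]; exact neg_ne_zero.2 hd0
  refine ⟨?_, ?_, ?_, ?_⟩
  · rw [map_mul, map_mul, map_mul, ha, hc, hd]; ring
  · rw [map_mul, map_mul, map_mul, ha, hc, hd]
    have : σ l * a * (l * e) + σ l * c * -d * (l * b / d) = l * σ l * (a * e - b * c) := by field_simp; ring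
    rw [this, hN]
  · rw [map_div₀, map_mul, map_mul, hb, he, hd]
    have : σ l * b / -d * (l * c * d) + σ l * e * (l * a) = l * σ l * (a * e - b * c) := by field_simp; ring
    rw [this, hN]
  · rw [map_div₀, map_mul, map_mul, hb, he, hd]; field_simp; ring

/-! ## §5 The dress: `U(σ, Φ₂)` and the `U(1,1)`-block of `H = Z_{U(Φ₃)}(diag(1,−1,1))` -/

/-- The four relations for `u ∈ U(σ, Φ₂)`, `Φ₂ = antidiag(1,1)` (★ `mem_unitaryGroupOfForm_antidiagonal_iff_sum'`). [cite: Rogawski1990, §1.9 p. 8] -/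
theorem rel_of_mem_unitaryGroupOfForm_two {u : GL (Fin 2) K} (hu : u ∈ unitaryGroupOfForm σ ((StdForm.antidiagonal 2).over K)) :
    σ ((u : Matrix (Fin 2) (Fin 2) K) 0 0) * (u : Matrix (Fin 2) (Fin 2) K) 1 0 + σ ((u : Matrix (Fin 2) (Fin 2) K) 1 0) * (u : Matrix (Fin 2) (Fin 2) K) 0 0 = 0 ∧
      σ ((u : Matrix (Fin 2) (Fin 2) K) 0 0) * (u : Matrix (Fin 2) (Fin 2) K) 1 1 + σ ((u : Matrix (Fin 2) (Fin 2) K) 1 0) * (u : Matrix (Fin 2) (Fin 2) K) 0 1 = 1 ∧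
      σ ((u : Matrix (Fin 2) (Fin 2) K) 0 1) * (u : Matrix (Fin 2) (Fin 2) K) 1 0 + σ ((u : Matrix (Fin 2) (Fin 2) K) 1 1) * (u : Matrix (Fin 2) (Fin 2) K) 0 0 = 1 ∧
      σ ((u : Matrix (Fin 2) (Fin 2) K) 0 1) * (u : Matrix (Fin 2) (Fin 2) K) 1 1 + σ ((u : Matrix (Fin 2) (Fin 2) K) 1 1) * (u : Matrix (Fin 2) (Fin 2) K) 0 1 = 0 := by
  rw [mem_unitaryGroupOfForm_antidiagonal_iff_sum'] at hu
  have h00 := hu 0 0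
  have h01 := hu 0 1
  have h10 := hu 1 0
  have h11 := hu 1 1
  simp only [Fin.sum_univ_two, Fin.rev_zero, Fin.isValue] at h00 h01 h10 h11
  refine ⟨?_, ?_, ?_, ?_⟩
  · simpa using h00
  · simpa using h01
  · simpa using h10
  · simpa using h11

/-- **THE DICTIONARY FOR `U(σ, Φ₂)`**: every `u ∈ U(σ, antidiag(1,1))(K)` is `λ · D₁⁻¹ g D₁` with `g ∈ GL₂(K^σ)`, `λσλ det g = 1` — in coordinates:
`∃ λ ≠ 0`, `det u · σλ = λ`, and `u₀₀∕λ, d u₀₁∕λ, u₁₀∕(dλ), u₁₁∕λ` are `σ`-fixed. [cite: Flicker1998UnitaryFL, Prop. 6 p. 83] -/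
theorem exists_fixed_coords_of_mem_unitaryGroupOfForm_two (h2 : (2 : K) ≠ 0) {d : K} (hd : σ d = -d) (hd0 : d ≠ 0)
    {u : GL (Fin 2) K} (hu : u ∈ unitaryGroupOfForm σ ((StdForm.antidiagonal 2).over K)) :
    ∃ l : K, l ≠ 0 ∧
      ((u : Matrix (Fin 2) (Fin 2) K) 0 0 * (u : Matrix (Fin 2) (Fin 2) K) 1 1 - (u : Matrix (Fin 2) (Fin 2) K) 0 1 * (u : Matrix (Fin 2) (Fin 2) K) 1 0) * σ l = l ∧
      σ ((u : Matrix (Fin 2) (Fin 2) K) 0 0 / l) = (u : Matrix (Fin 2) (Fin 2) K) 0 0 / l ∧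
      σ (d * (u : Matrix (Fin 2) (Fin 2) K) 0 1 / l) = d * (u : Matrix (Fin 2) (Fin 2) K) 0 1 / l ∧
      σ ((u : Matrix (Fin 2) (Fin 2) K) 1 0 / (d * l)) = (u : Matrix (Fin 2) (Fin 2) K) 1 0 / (d * l) ∧
      σ ((u : Matrix (Fin 2) (Fin 2) K) 1 1 / l) = (u : Matrix (Fin 2) (Fin 2) K) 1 1 / l := by
  obtain ⟨R1, R2, R3, R4⟩ := rel_of_mem_unitaryGroupOfForm_two σ hu
  obtain ⟨l, hl0, hl, h1, h2', h3, h4, -⟩ := exists_fixed_coords σ h2 hd hd0 R1 R2 R3 R4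
  exact ⟨l, hl0, hl, h1, h2', h3, h4⟩

/-- The four relations for the `U(1,1)`-BLOCK `(α β; γ δ)` of an element `!![α,0,β;0,e,0;γ,0,δ]` of `U(σ, Φ₃)` (the shape of `H = Z(diag(1,−1,1))`,
★ `exists_coe_eq_block_of_mem_centralizer`), and `σe · e = 1`. [cite: Flicker1998UnitaryFL, Prop. 4 p. 81; Prop. 6 p. 83] -/
theorem rel_of_coe_eq_block {h : GL (Fin 3) K} (hh3 : h ∈ unitaryGroupOfForm σ ((StdForm.antidiagonal 3).over K)) {α β γ δ e : K}
    (hh : (h : Matrix (Fin 3) (Fin 3) K) = !![α, 0, β; 0, e, 0; γ, 0, δ]) :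
    (σ α * γ + σ γ * α = 0 ∧ σ α * δ + σ γ * β = 1 ∧ σ β * γ + σ δ * α = 1 ∧ σ β * δ + σ δ * β = 0) ∧ σ e * e = 1 := by
  rw [mem_unitaryGroupOfForm_antidiagonal_iff_sum'] at hh3
  have h00 := hh3 0 0
  have h02 := hh3 0 2
  have h20 := hh3 2 0
  have h22 := hh3 2 2
  have h11 := hh3 1 1
  have r0 : Fin.rev (0 : Fin 3) = 2 := rfl
  have r1 : Fin.rev (1 : Fin 3) = 1 := rfl
  have r2 : Fin.rev (2 : Fin 3) = 0 := rfl
  simp only [Fin.sum_univ_three, r0, r1, r2, hh, Fin.isValue, of_apply, cons_val', cons_val_zero, cons_val_one, cons_val_two,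
    empty_val', cons_val_fin_one, map_zero, zero_mul, mul_zero, add_zero, zero_add] at h00 h02 h20 h22 h11
  refine ⟨⟨?_, ?_, ?_, ?_⟩, ?_⟩
  · simpa using h00
  · simpa using h02
  · simpa using h20
  · simpa using h22
  · simpa using h11

/-- **THE DICTIONARY ON `H = Z_{U(Φ₃)}(diag(1,−1,1)) ≅ U(1,1) × U(1)`**: for `h = !![α,0,β;0,e,0;γ,0,δ] ∈ U(σ, Φ₃)` there is `λ ≠ 0` with
`(αδ − βγ)·σλ = λ` and `α∕λ, dβ∕λ, γ∕(dλ), δ∕λ ∈ K^σ` (the `U(1,1)`-block is `λ · D₁⁻¹ g D₁`, `g ∈ GL₂(K^σ)`, `λσλ det g = 1`), and `σe·e = 1`.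
[cite: Flicker1998UnitaryFL, Prop. 6 p. 83] -/
theorem exists_fixed_coords_of_coe_eq_block (h2 : (2 : K) ≠ 0) {d : K} (hd : σ d = -d) (hd0 : d ≠ 0)
    {h : GL (Fin 3) K} (hh3 : h ∈ unitaryGroupOfForm σ ((StdForm.antidiagonal 3).over K)) {α β γ δ e : K}
    (hh : (h : Matrix (Fin 3) (Fin 3) K) = !![α, 0, β; 0, e, 0; γ, 0, δ]) :
    (∃ l : K, l ≠ 0 ∧ (α * δ - β * γ) * σ l = l ∧
      σ (α / l) = α / l ∧ σ (d * β / l) = d * β / l ∧ σ (γ / (d * l)) = γ / (d * l) ∧ σ (δ / l) = δ / l ∧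
        l * σ l * (α / l * (δ / l) - d * β / l * (γ / (d * l))) = 1) ∧ σ e * e = 1 := by
  obtain ⟨⟨R1, R2, R3, R4⟩, he⟩ := rel_of_coe_eq_block σ hh3 hh
  exact ⟨exists_fixed_coords σ h2 hd hd0 R1 R2 R3 R4, he⟩

end SplitDictionary

end Literature.NumberTheory.Automorphic.UnitaryGroup
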